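import Mathlib.RingTheory.PowerSeries.Expand
import Literature.NumberTheory.EllipticCurves.ModularPolynomial
import Literature.NumberTheory.EllipticCurves.QSeriesDisc
import Literature.NumberTheory.Transcendental.MahlerManinPadicStep
import HarnessLib

/-!
# The modular equations of prime level hold `p`-adically (the `q`-expansion bridge)

Everything in this file is **proved**; there are no new definitions.  The tree constructs, for
every prime `ℓ`, the modular equation `Φ_ℓ(X, Y) ∈ ℂ[Y][X]`
(`Literature.NumberTheory.EllipticCurves.modularPolynomial ℓ`, `ModularPolynomial.lean`; Cox,
*Primes of the form x² + ny²*, §11.B) with **`Φ_ℓ(j(ℓτ), j(τ)) = 0`** on `ℍ`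
(`modularPolynomial_kleinJ_mulPoint`).  Here we transport this identity to the `p`-ADIC values of
`J = tateJ = E₄³/Δ` (the input `hrel` of `tateJ_transcendental_of_relations`,
`MahlerManinConclusion.lean`):

* `evalSeries_expand` — `p`-adic evaluation commutes with `X ↦ X^d`;
* `modularRelation_powerSeries_eq_zero` — if `Φ ∈ ℤ[X][Y]` maps to `Φ_ℓ`, the INTEGER power series
  `Ψ = Σ_{m,i} c_{m,i} (XJ)^i X^{D-i} (XJ ∘ X^ℓ)^m X^{ℓ(N-m)} ∈ ℤ⟦X⟧` (the `q`-expansion of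
  `q^{D+ℓN} Φ_ℓ(j(ℓτ), j(τ))`, `XJ = formalXJ = q·j`) VANISHES: its complex evaluation at every
  `q(τ)` is `q^{D+ℓN} Φ_ℓ(j(ℓτ), j(τ)) = 0` (`evalDisc` of `QSeriesDisc.lean`), so the `q`-expansion
  principle (`discSeries_eq_of_evalDisc_qParam_eq`) applies;
* `modularRelation_padic` — evaluating `Ψ = 0` `p`-adically (`evalSeries`, `evalSeries_formalXJ`):
  **`Φ(J(q^ℓ), J(q)) = 0`** in any complete ultrametric field for `0 < ‖q‖ < 1`
  (Nesterenko–Philippon Ch. 2 §2.2: `Φ_n(J(z), J(zⁿ)) = 0` on the punctured disc; BDGP use the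
  modular equations in `ℂ_p`).

## References

* [NesterenkoPhilippon2001] LNM 1752, Ch. 2 (G. Diaz), §2.2 (modular polynomials), Thm. 2.11.
* D. A. Cox, *Primes of the form x² + ny²*, 2nd ed., Wiley 2013, §11.B (11.14)–(11.15). [Cox2013]
* [BarreSirieixDiazGramainPhilibert1996Manin] Invent. Math. 124 (1996) 1–9, §1.
-/

noncomputable section

open Finset PowerSeries Complex
open UpperHalfPlane hiding I
open Literature.NumberTheory.EllipticCurves Literature.NumberTheory.EllipticCurves.ModularForms

namespace Literature.NumberTheory.Transcendental

/-! ### `p`-adic evaluation and `X ↦ X^d` -/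

section Eval

variable {K : Type*} [NontriviallyNormedField K] [IsUltrametricDist K] [CompleteSpace K]

omit [IsUltrametricDist K] [CompleteSpace K] in
/-- `evalSeries (expand d φ) z = evalSeries φ (z^d)`. [folklore] -/
theorem evalSeries_expand (d : ℕ) (hd : d ≠ 0) (φ : PowerSeries ℤ) (z : K) :
    evalSeries (PowerSeries.expand d hd φ) z = evalSeries φ (z ^ d) := by
  simp only [evalSeries]
  have hinj : Function.Injective (fun n : ℕ ↦ d * n) := mul_right_injective₀ hd
  rw [← hinj.tsum_eq]
  · simp only [PowerSeries.coeff_expand_mul, pow_mul]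
  · intro m hm
    by_contra hm'
    rw [Set.mem_range, not_exists] at hm'
    exact hm (by
      show ((coeff m (PowerSeries.expand d hd φ) : ℤ) : K) * z ^ m = 0
      rw [coeff_expand_of_not_dvd _ _ _ fun ⟨n, hn⟩ ↦ hm' n hn.symm, Int.cast_zero, zero_mul])

end Eval

/-! ### The `q`-expansion of `q^{D + ℓN} Φ_ℓ(j(ℓτ), j(τ))` vanishes -/

/-- `q(ℓτ) = q(τ)^ℓ`. [folklore] -/
theorem qParam_mulPoint (ℓ : ℕ) [Fact ℓ.Prime] (τ : ℍ) :
    Function.Periodic.qParam 1 (mulPoint ℓ τ) = Function.Periodic.qParam 1 τ ^ ℓ := by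
  rw [qParam_one_eq_cexp, qParam_one_eq_cexp, coe_mulPoint, ← Complex.exp_nat_mul]
  congr 1
  ring

/-- The relation polynomial evaluated: for `Φ ∈ ℤ[X][Y]` with `deg_Y Φ.coeff m ≤ D` for all `m`,
`Σ_{m ≤ N} Σ_{i ≤ D} c_{m,i} yⁱ xᵐ = Φ(x, y)`, where `Φ(x, y) = ((Φ.map (eval₂RingHom f y)).eval x`
and `N = deg_X Φ`. [folklore] -/
theorem sum_sum_coeff_mul_pow_mul_pow_eq_eval {R : Type*} [CommRing R] (f : ℤ →+* R)
    (Φ : Polynomial (Polynomial ℤ)) {D : ℕ} (hD : ∀ m, (Φ.coeff m).natDegree ≤ D) (x y : R) :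
    ∑ m ∈ range (Φ.natDegree + 1), ∑ i ∈ range (D + 1),
        f ((Φ.coeff m).coeff i) * y ^ i * x ^ m =
      (Φ.map (Polynomial.eval₂RingHom f y)).eval x := by
  rw [Polynomial.eval_map, Polynomial.eval₂_eq_sum_range]
  refine sum_congr rfl fun m _ ↦ ?_
  rw [Polynomial.coe_eval₂RingHom, Polynomial.eval₂_eq_sum_range' f (Nat.lt_succ_of_le (hD m)),
    sum_mul]

/-- **The `q`-expansion of the modular relation vanishes.**  Let `ℓ` be prime and let
`Φ ∈ ℤ[X][Y]` be an integer polynomial mapping to the modular equation `Φ_ℓ(X, Y) ∈ ℂ[Y][X]`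
(`modularPolynomial ℓ`), with `deg_Y` of its coefficients `≤ D`; put `N = deg_X Φ`.  Then the
integer power series `Σ_{m ≤ N} Σ_{i ≤ D} c_{m,i} (XJ)^i X^{D-i} (XJ(X^ℓ))^m X^{ℓ(N-m)}`
(`XJ = formalXJ`, the `q`-expansion of `q·j`) is ZERO: it is the `q`-expansion of
`q^{D+ℓN} Φ_ℓ(j(ℓτ), j(τ)) = 0` (Cox (11.15); Nesterenko–Philippon Ch. 2 §2.2:
`Φ_n(J(z), J(zⁿ)) = 0` on the punctured disc). [cite: NesterenkoPhilippon2001, Ch. 2, §2.2] -/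
theorem modularRelation_powerSeries_eq_zero (ℓ : ℕ) [Fact ℓ.Prime] (Φ : Polynomial (Polynomial ℤ))
    (hΦ : Φ.map (Polynomial.mapRingHom (Int.castRingHom ℂ)) = modularPolynomial ℓ) {D : ℕ}
    (hD : ∀ m, (Φ.coeff m).natDegree ≤ D) :
    (∑ m ∈ range (Φ.natDegree + 1), ∑ i ∈ range (D + 1),
      PowerSeries.C ((Φ.coeff m).coeff i) * formalXJ ^ i * X ^ (D - i) *
        (PowerSeries.expand ℓ (Fact.out : ℓ.Prime).ne_zero formalXJ) ^ m *
          X ^ (ℓ * (Φ.natDegree - m)) : PowerSeries ℤ) = 0 := by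
  have hℓ : ℓ ≠ 0 := (Fact.out : ℓ.Prime).ne_zero
  set N := Φ.natDegree with hN
  -- the series as an element of `discSeries`
  set Ψd : discSeries := ∑ m ∈ range (N + 1), ∑ i ∈ range (D + 1),
    (⟨PowerSeries.C (((Φ.coeff m).coeff i : ℤ) : ℂ), C_mem_discSeries _⟩ : discSeries) *
      (⟨PowerSeries.map (Int.castRingHom ℂ) formalXJ, map_formalXJ_mem_discSeries⟩ : discSeries) ^ i *
      (⟨X, X_mem_discSeries⟩ : discSeries) ^ (D - i) *
      (⟨PowerSeries.expand ℓ hℓ (PowerSeries.map (Int.castRingHom ℂ) formalXJ),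
        expand_mem_discSeries map_formalXJ_mem_discSeries ℓ hℓ⟩ : discSeries) ^ m *
      (⟨X, X_mem_discSeries⟩ : discSeries) ^ (ℓ * (N - m)) with hΨd
  have hΨcoe : (Ψd : PowerSeries ℂ) = PowerSeries.map (Int.castRingHom ℂ)
      (∑ m ∈ range (N + 1), ∑ i ∈ range (D + 1),
        PowerSeries.C ((Φ.coeff m).coeff i) * formalXJ ^ i * X ^ (D - i) *
          (PowerSeries.expand ℓ hℓ formalXJ) ^ m * X ^ (ℓ * (N - m))) := by
    rw [hΨd]
    simp only [AddSubmonoidClass.coe_finsetSum, Subring.coe_mul, SubmonoidClass.coe_pow, map_sum,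
      map_mul, map_pow, PowerSeries.map_X, PowerSeries.map_expand, eq_intCast, map_intCast]
  -- its evaluation at `q(τ)` is `q^{D + ℓ N} Φ_ℓ(j(ℓτ), j(τ)) = 0`
  have heval : ∀ τ : ℍ,
      evalDisc (Function.Periodic.qParam 1 τ) (norm_qParam_one_lt_one τ) Ψd = 0 := by
    intro τ
    have hj : evalDisc (Function.Periodic.qParam 1 τ) (norm_qParam_one_lt_one τ)
        ⟨PowerSeries.map (Int.castRingHom ℂ) formalXJ, map_formalXJ_mem_discSeries⟩ =
        Function.Periodic.qParam 1 τ * kleinJ τ := evalDisc_qParam_formalXJ τ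
    have hx : evalDisc (Function.Periodic.qParam 1 τ) (norm_qParam_one_lt_one τ)
        ⟨X, X_mem_discSeries⟩ = Function.Periodic.qParam 1 τ := evalDisc_X _
    have hjl : evalDisc (Function.Periodic.qParam 1 τ) (norm_qParam_one_lt_one τ)
        ⟨PowerSeries.expand ℓ hℓ (PowerSeries.map (Int.castRingHom ℂ) formalXJ),
          expand_mem_discSeries map_formalXJ_mem_discSeries ℓ hℓ⟩ =
        Function.Periodic.qParam 1 τ ^ ℓ * kleinJ (mulPoint ℓ τ) := by
      rw [evalDisc_expand map_formalXJ_mem_discSeries hℓ (norm_qParam_one_lt_one τ)]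
      have h := evalDisc_qParam_formalXJ (mulPoint ℓ τ)
      have key : ∀ (w : ℂ) (hw : ‖w‖ < 1), w = Function.Periodic.qParam 1 (mulPoint ℓ τ) →
          evalDisc w hw ⟨PowerSeries.map (Int.castRingHom ℂ) formalXJ, map_formalXJ_mem_discSeries⟩ =
            w * kleinJ (mulPoint ℓ τ) := by
        rintro w hw rfl
        exact h
      exact key _ _ (qParam_mulPoint ℓ τ).symm
    have hC : ∀ c : ℂ, evalDisc (Function.Periodic.qParam 1 τ) (norm_qParam_one_lt_one τ)
        ⟨PowerSeries.C c, C_mem_discSeries c⟩ = c := evalDisc_C _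
    rw [hΨd, map_sum]
    simp only [map_sum, map_mul, map_pow, hj, hx, hjl, hC]
    -- collect the powers of `q`
    have hterm : ∀ m ∈ range (N + 1), ∀ i ∈ range (D + 1),
        (((Φ.coeff m).coeff i : ℤ) : ℂ) * (Function.Periodic.qParam 1 τ * kleinJ τ) ^ i *
            Function.Periodic.qParam 1 τ ^ (D - i) *
            (Function.Periodic.qParam 1 τ ^ ℓ * kleinJ (mulPoint ℓ τ)) ^ m *
            Function.Periodic.qParam 1 τ ^ (ℓ * (N - m)) =
          Function.Periodic.qParam 1 τ ^ (D + ℓ * N) *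
            ((Int.castRingHom ℂ) ((Φ.coeff m).coeff i) * kleinJ τ ^ i * kleinJ (mulPoint ℓ τ) ^ m) := by
      intro m hm i hi
      have hm' : m ≤ N := Nat.lt_succ_iff.mp (mem_range.mp hm)
      have hi' : i ≤ D := Nat.lt_succ_iff.mp (mem_range.mp hi)
      rw [eq_intCast]
      have e1 : Function.Periodic.qParam 1 τ ^ (D + ℓ * N) =
          Function.Periodic.qParam 1 τ ^ i * Function.Periodic.qParam 1 τ ^ (D - i) *
            ((Function.Periodic.qParam 1 τ ^ ℓ) ^ m *
              Function.Periodic.qParam 1 τ ^ (ℓ * (N - m))) := by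
        rw [← pow_add, Nat.add_sub_cancel' hi', ← pow_mul, ← pow_add, ← Nat.mul_add,
          Nat.add_sub_cancel' hm', pow_add]
      rw [e1]
      ring
    rw [sum_congr rfl fun m hm ↦ sum_congr rfl fun i hi ↦ hterm m hm i hi]
    simp_rw [← mul_sum]
    rw [sum_sum_coeff_mul_pow_mul_pow_eq_eval (Int.castRingHom ℂ) Φ hD]
    -- `Φ(j(ℓτ), j(τ)) = Φ_ℓ(j(ℓτ), j(τ)) = 0`
    have hrel : (Φ.map (Polynomial.eval₂RingHom (Int.castRingHom ℂ) (kleinJ τ))).eval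
        (kleinJ (mulPoint ℓ τ)) = 0 := by
      have h := modularPolynomial_kleinJ_mulPoint (p := ℓ) τ
      rw [← hΦ, Polynomial.map_map] at h
      have hcomp : (Polynomial.evalRingHom (kleinJ τ)).comp
          (Polynomial.mapRingHom (Int.castRingHom ℂ)) =
          Polynomial.eval₂RingHom (Int.castRingHom ℂ) (kleinJ τ) := by
        refine Polynomial.ringHom_ext (fun z ↦ by simp) ?_
        simp
      rw [hcomp] at h
      exact h
    rw [hrel, mul_zero]
  -- hence `Ψ = 0` over `ℂ`, then over `ℤ`
  have hΨ0 : Ψd = 0 :=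
    discSeries_eq_of_evalDisc_qParam_eq one_pos fun τ ↦ by rw [heval τ, map_zero]
  have hmap : (Ψd : PowerSeries ℂ) = ((0 : discSeries) : PowerSeries ℂ) := congr_arg _ hΨ0
  rw [hΨcoe, ZeroMemClass.coe_zero] at hmap
  exact PowerSeries.map_injective (Int.castRingHom ℂ) Int.cast_injective (by rw [hmap, map_zero])

/-- **The modular relation holds `p`-adically.**  With `ℓ`, `Φ`, `D` as in
`modularRelation_powerSeries_eq_zero`, for every `q ∈ ℚ_p` (indeed any complete ultrametric field)
with `0 < ‖q‖ < 1`: `Φ(J(q^ℓ), J(q)) = 0`, `J = tateJ = E₄³/Δ` — the `p`-adic form of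
`Φ_ℓ(j(ℓτ), j(τ)) = 0` (BDGP 1996 use the modular equations in `ℂ_p`; Nesterenko–Philippon Ch. 2
§2.2 and "the same result holds in `p`-adic"). [cite: NesterenkoPhilippon2001, Ch. 2, §2.2] -/
theorem modularRelation_padic {K : Type*} [NontriviallyNormedField K] [IsUltrametricDist K]
    [CompleteSpace K]
    (ℓ : ℕ) [Fact ℓ.Prime] (Φ : Polynomial (Polynomial ℤ))
    (hΦ : Φ.map (Polynomial.mapRingHom (Int.castRingHom ℂ)) = modularPolynomial ℓ) {D : ℕ}
    (hD : ∀ m, (Φ.coeff m).natDegree ≤ D) {q : K} (hq0 : q ≠ 0) (hq1 : ‖q‖ < 1) :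
    (Φ.map (Polynomial.eval₂RingHom (Int.castRingHom K) (tateJ q))).eval (tateJ (q ^ ℓ)) = 0 := by
  have hℓ : ℓ ≠ 0 := (Fact.out : ℓ.Prime).ne_zero
  set N := Φ.natDegree with hN
  have hzero := modularRelation_powerSeries_eq_zero ℓ Φ hΦ hD
  have hev : evalSeries (∑ m ∈ range (N + 1), ∑ i ∈ range (D + 1),
      PowerSeries.C ((Φ.coeff m).coeff i) * formalXJ ^ i * X ^ (D - i) *
        (PowerSeries.expand ℓ hℓ formalXJ) ^ m * X ^ (ℓ * (N - m))) q =
      evalSeries (0 : PowerSeries ℤ) q := by rw [hzero]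
  have hqℓ0 : q ^ ℓ ≠ 0 := pow_ne_zero ℓ hq0
  have hqℓ1 : ‖q ^ ℓ‖ < 1 := by rw [norm_pow]; exact pow_lt_one₀ (norm_nonneg _) hq1 hℓ
  rw [evalSeries_zero, evalSeries_finset_sum _ _ hq1] at hev
  have hX : evalSeries (X : PowerSeries ℤ) q = q := by simpa using evalSeries_X_pow 1 q
  simp only [evalSeries_finset_sum _ _ hq1, evalSeries_mul _ _ hq1, evalSeries_pow _ hq1,
    evalSeries_C, hX, evalSeries_expand ℓ hℓ, evalSeries_formalXJ hq0 hq1,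
    evalSeries_formalXJ hqℓ0 hqℓ1] at hev
  -- collect the powers of `q`
  have hterm : ∀ m ∈ range (N + 1), ∀ i ∈ range (D + 1),
      (((Φ.coeff m).coeff i : ℤ) : K) * (q * tateJ q) ^ i * q ^ (D - i) *
          (q ^ ℓ * tateJ (q ^ ℓ)) ^ m * q ^ (ℓ * (N - m)) =
        q ^ (D + ℓ * N) * ((Int.castRingHom K) ((Φ.coeff m).coeff i) * tateJ q ^ i *
          tateJ (q ^ ℓ) ^ m) := by
    intro m hm i hi
    have hm' : m ≤ N := Nat.lt_succ_iff.mp (mem_range.mp hm)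
    have hi' : i ≤ D := Nat.lt_succ_iff.mp (mem_range.mp hi)
    rw [eq_intCast]
    have e1 : q ^ (D + ℓ * N) = q ^ i * q ^ (D - i) * ((q ^ ℓ) ^ m * q ^ (ℓ * (N - m))) := by
      rw [← pow_add, Nat.add_sub_cancel' hi', ← pow_mul, ← pow_add, ← Nat.mul_add,
        Nat.add_sub_cancel' hm', pow_add]
    rw [e1]
    ring
  rw [sum_congr rfl fun m hm ↦ sum_congr rfl fun i hi ↦ hterm m hm i hi] at hev
  simp_rw [← mul_sum] at hev
  rw [sum_sum_coeff_mul_pow_mul_pow_eq_eval (Int.castRingHom K) Φ hD] at hev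
  exact (mul_eq_zero.mp hev).resolve_left (pow_ne_zero _ hq0)

end Literature.NumberTheory.Transcendental

end
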